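import Summits.SmoothPoincare4.SmoothPoincare4.Theorems.SblfDescentRungOneHelperDxZones
import Summits.SmoothPoincare4.SmoothPoincare4.Theorems.SblfDescentRungOneHelperDxTorus
import HarnessLib

/-!
# Disc extension, layer 6: the glued angular map on the torus disc — smoothness and fibrewise rank

Auxiliary file of helper `helper_sliceGluing_discExtension` (apex leaf DX: extension of the
torus angular coordinate over the torus disc), line `Sketch`, crux `SblfDescent.RungOne`.

(Crux item stmt-SmoothPoincare4-18531; skeleton `Cruxes/RungOne/Lines/Sketch.lean`.)

In the abstract setting of layer 5 (`Ψ₀`, `Θ`, `P`, `g`, radii `a - 7d < ⋯ < a`) we glue the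
zone formulas into one map `Acore : Fb × ℝ² → Circle`,

* `‖w‖ < a - 7d`: `(Ψ₀ θ).1` (constant in `w`: the polar fibre included);
* `a - 7d ≤ ‖w‖ < a - 7d/2`: `G3 θ ‖w‖ (angW w)` (Earle–Eells deformation and unwinding);
* `a - 7d/2 ≤ ‖w‖ < a`: `G2 θ ‖w‖ (angW w)` (radius freezing and angle flattening);
* `a ≤ ‖w‖`: `(Θ w (Ψ₀ θ)).1` (the given angular coordinate of the band),

and prove that it is `C^∞` on `Fb × {‖w‖ < a + d}` (`contMDiffOn_Acore`: consecutive formulas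
agree on open overlapping shells, and each is smooth in polar form by
`contMDiffAt_polar_of_periodic`) and that on every fibre `θ ↦ Acore (θ, w)` has non-zero
differential (`mfderiv_Acore_slice_ne_zero`: each zone formula is, fibrewise, the first
coordinate of a diffeomorphism of the torus, possibly followed by a rotation).  Everything is
folklore differential topology.
-/

set_option linter.dupNamespace false

noncomputable section

open scoped Manifold ContDiff Topology Real
open Set Function Metric Literature.Topology.FourManifolds

namespace Summit.SmoothPoincare4.SmoothPoincare4.Cruxes.RungOne.Sketch

namespace DiscExt

/-- Local notation: `𝔼 n` is the model Euclidean space `EuclideanSpace ℝ (Fin n)`. -/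
local notation "𝔼 " n:arg => EuclideanSpace ℝ (Fin n)

/-- Local notation: `𝕊¹`, the unit circle of `ℝ²`. -/
local notation "𝕊¹" => (Metric.sphere (0 : EuclideanSpace ℝ (Fin 2)) (1 : ℝ))

/-- Local notation: the model with corners of the torus `Circle × Circle`. -/
local notation "𝓣" => (ModelWithCorners.prod (𝓡 1) (𝓡 1))

attribute [local instance] Literature.Topology.FourManifolds.fact_finrank_euclideanSpace_succ

/-! ### Differential tools -/

section Tools

variable {EM : Type*} [NormedAddCommGroup EM] [NormedSpace ℝ EM] {HM : Type*} [TopologicalSpace HM]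
  {I : ModelWithCorners ℝ EM HM} {M : Type*} [TopologicalSpace M] [ChartedSpace HM M]
  {EN : Type*} [NormedAddCommGroup EN] [NormedSpace ℝ EN] {HN : Type*} [TopologicalSpace HN]
  {J : ModelWithCorners ℝ EN HN} {N : Type*} [TopologicalSpace N] [ChartedSpace HN N]
  {EK : Type*} [NormedAddCommGroup EK] [NormedSpace ℝ EK] {HK : Type*} [TopologicalSpace HK]
  {K : ModelWithCorners ℝ EK HK} {Q : Type*} [TopologicalSpace Q] [ChartedSpace HK Q]

/-- **Surjective differentials compose.** [folklore] -/
theorem surjective_mfderiv_comp {φ : M → N} {ψ : N → Q} {x : M} (hψ : ContMDiffAt J K ∞ ψ (φ x))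
    (hφ : ContMDiffAt I J ∞ φ x) (hψs : Surjective (mfderiv J K ψ (φ x)))
    (hφs : Surjective (mfderiv I J φ x)) : Surjective (mfderiv I K (ψ ∘ φ) x) := by
  rw [mfderiv_comp x (hψ.mdifferentiableAt (by simp)) (hφ.mdifferentiableAt (by simp))]
  exact hψs.comp hφs

end Tools

/-- The first projection `T → Circle` has surjective differential. [folklore] -/
theorem surjective_mfderiv_fst_torus (p : Circle × Circle) :
    Surjective (mfderiv 𝓣 (𝓡 1) (Prod.fst : Circle × Circle → Circle) p) := by
  rw [mfderiv_fst]
  exact fun z ↦ ⟨(z, 0), rfl⟩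

/-- Left multiplication in `Circle` has surjective differential. [folklore] -/
theorem surjective_mfderiv_mul_left (c z : Circle) :
    Surjective (mfderiv (𝓡 1) (𝓡 1) (fun z : Circle ↦ c * z) z) :=
  surjective_mfderiv_of_inverse (G := fun z : Circle ↦ c⁻¹ * z) (contMDiff_mul_left (a := c)).contMDiffAt
    (contMDiff_mul_left (a := c⁻¹)).contMDiffAt (inv_mul_cancel_left c z) fun y ↦ mul_inv_cancel_left c y

/-- A linear map onto the tangent line of `Circle` is non-zero. [folklore] -/
theorem ne_zero_of_surjective_circle {Fb : Type} [TopologicalSpace Fb] [ChartedSpace (𝔼 2) Fb]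
    {F : Fb → Circle} {θ : Fb} (h : Surjective (mfderiv (𝓡 2) (𝓡 1) F θ)) :
    mfderiv (𝓡 2) (𝓡 1) F θ ≠ 0 := by
  intro h0
  obtain ⟨ξ, hξ⟩ := h (EuclideanSpace.single 0 1)
  rw [h0] at hξ
  have h1 : (EuclideanSpace.single (0 : Fin 1) (1 : ℝ) : 𝔼 1) 0 = (0 : 𝔼 1) 0 :=
    congrArg (fun z : 𝔼 1 ↦ z 0) hξ.symm
  rw [show (EuclideanSpace.single (0 : Fin 1) (1 : ℝ) : 𝔼 1) 0 = 1 by simp] at h1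
  exact one_ne_zero (h1.trans rfl)

/-! ### The glued map -/

section Core

variable {Fb : Type} [TopologicalSpace Fb] [ChartedSpace (𝔼 2) Fb]
  (Ψ₀ : Fb → Circle × Circle) (Θ : 𝔼 2 → Circle × Circle → Circle × Circle)
  (P : ℝ → ℝ → Circle × Circle → Circle × Circle) (gφ : ℝ → ℝ) (a d : ℝ)

/-- **The glued angular map on the torus disc** (see the module docstring). [folklore] -/
def Acore (q : Fb × 𝔼 2) : Circle :=
  if ‖q.2‖ < a - 7 * d then (Ψ₀ q.1).1
  else if ‖q.2‖ < a - 7 * d / 2 then G3 Ψ₀ P gφ a d q.1 ‖q.2‖ (angW q.2)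
  else if ‖q.2‖ < a then G2 Ψ₀ Θ a d q.1 ‖q.2‖ (angW q.2)
  else (Θ q.2 (Ψ₀ q.1)).1

variable {Ψ₀ Θ P gφ a d}

omit [TopologicalSpace Fb] [ChartedSpace (𝔼 2) Fb] in
/-- `Acore` on the core `‖w‖ < a - 7d`. [folklore] -/
theorem Acore_core {θ : Fb} {w : 𝔼 2} (h : ‖w‖ < a - 7 * d) :
    Acore Ψ₀ Θ P gφ a d (θ, w) = (Ψ₀ θ).1 := by
  simp only [Acore, if_pos h]

omit [TopologicalSpace Fb] [ChartedSpace (𝔼 2) Fb] in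
/-- `Acore` on the shell `a - 7d ≤ ‖w‖ < a - 7d/2`. [folklore] -/
theorem Acore_shell3 {θ : Fb} {w : 𝔼 2} (h1 : a - 7 * d ≤ ‖w‖) (h2 : ‖w‖ < a - 7 * d / 2) :
    Acore Ψ₀ Θ P gφ a d (θ, w) = G3 Ψ₀ P gφ a d θ ‖w‖ (angW w) := by
  simp only [Acore, if_neg (not_lt.2 h1), if_pos h2]

omit [TopologicalSpace Fb] [ChartedSpace (𝔼 2) Fb] in
/-- `Acore` on the shell `a - 7d/2 ≤ ‖w‖ < a`. [folklore] -/
theorem Acore_shell2 (hd : 0 < d) {θ : Fb} {w : 𝔼 2} (h1 : a - 7 * d / 2 ≤ ‖w‖) (h2 : ‖w‖ < a) :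
    Acore Ψ₀ Θ P gφ a d (θ, w) = G2 Ψ₀ Θ a d θ ‖w‖ (angW w) := by
  have h0 : ¬ ‖w‖ < a - 7 * d := not_lt.2 (by linarith)
  simp only [Acore, if_neg h0, if_neg (not_lt.2 h1), if_pos h2]

omit [TopologicalSpace Fb] [ChartedSpace (𝔼 2) Fb] in
/-- `Acore` on the band `a ≤ ‖w‖`. [folklore] -/
theorem Acore_band (hd : 0 < d) {θ : Fb} {w : 𝔼 2} (h : a ≤ ‖w‖) :
    Acore Ψ₀ Θ P gφ a d (θ, w) = (Θ w (Ψ₀ θ)).1 := by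
  have h0 : ¬ ‖w‖ < a - 7 * d := not_lt.2 (by linarith)
  have h1 : ¬ ‖w‖ < a - 7 * d / 2 := not_lt.2 (by linarith)
  simp only [Acore, if_neg h0, if_neg h1, if_neg (not_lt.2 h)]

/-! ### Smoothness -/

/-- **`Acore` is smooth on `Fb × {‖w‖ < a + d}`.** [folklore] -/
theorem contMDiffOn_Acore (hd : 0 < d) (ha : 0 < a - 7 * d) (hΨs : ContMDiff (𝓡 2) 𝓣 ∞ Ψ₀)
    (hΘs : ContMDiffOn (𝓘(ℝ, 𝔼 2).prod 𝓣) 𝓣 ∞ (fun q : 𝔼 2 × (Circle × Circle) ↦ Θ q.1 q.2)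
      ({w : 𝔼 2 | a - 3 * d < ‖w‖ ∧ ‖w‖ < a + 2 * d} ×ˢ univ))
    (hPs : ContMDiff (𝓘(ℝ, ℝ).prod (𝓘(ℝ, ℝ).prod 𝓣)) 𝓣 ∞
      fun p : ℝ × (ℝ × (Circle × Circle)) ↦ P p.1 p.2.1 p.2.2)
    (hPid : ∀ σ t, t ≤ 0 ∨ 1 ≤ t → ∀ x, P σ t x = x)
    (hP1 : ∀ t x, P 1 t x = Θ ((a - 2 * d) • ((circlePt (stepQ t) : 𝕊¹) : 𝔼 2)) x)
    (hP0 : ∀ t x, (P 0 (stepQ (Int.fract t)) x).1 = Circle.exp (2 * π * gφ t) * x.1)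
    (hgs : ContDiff ℝ ∞ gφ) (hgp : ∀ t, gφ (t + 1) = gφ t) :
    ContMDiffOn ((𝓡 2).prod (𝓡 2)) (𝓡 1) ∞ (Acore Ψ₀ Θ P gφ a d) (univ ×ˢ ball (0 : 𝔼 2) (a + d)) := by
  rintro ⟨θ, w⟩ ⟨-, hw⟩
  rw [mem_ball_zero_iff] at hw
  apply ContMDiffAt.contMDiffWithinAt
  have hnormc : Continuous fun q : Fb × 𝔼 2 ↦ ‖q.2‖ := continuous_norm.comp continuous_snd
  rcases lt_or_ge ‖w‖ (a - 7 * d) with hA | hA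
  · -- the core
    have hev : Acore Ψ₀ Θ P gφ a d =ᶠ[𝓝 (θ, w)] fun q ↦ (Ψ₀ q.1).1 := by
      filter_upwards [(isOpen_lt hnormc continuous_const).mem_nhds (show ‖((θ, w) : Fb × 𝔼 2).2‖ < a - 7 * d
        from hA)] with q hq
      exact Acore_core hq
    refine ContMDiffAt.congr_of_eventuallyEq ?_ hev
    exact (contMDiff_fst.comp (hΨs.comp contMDiff_fst)).contMDiffAt
  have hw0 : w ≠ 0 := by
    rw [← norm_pos_iff]; linarith
  rcases lt_or_ge ‖w‖ (a - 7 * d / 2) with hB | hB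
  · -- zone 3/4, in polar form
    have hev : Acore Ψ₀ Θ P gφ a d =ᶠ[𝓝 (θ, w)] fun q ↦ G3 Ψ₀ P gφ a d q.1 ‖q.2‖ (angW q.2) := by
      have ho : IsOpen {q : Fb × 𝔼 2 | q.2 ≠ 0 ∧ ‖q.2‖ < a - 7 * d / 2} :=
        (isOpen_ne.preimage continuous_snd).inter (isOpen_lt hnormc continuous_const)
      filter_upwards [ho.mem_nhds (show (θ, w) ∈ {q : Fb × 𝔼 2 | q.2 ≠ 0 ∧ ‖q.2‖ < a - 7 * d / 2}
        from ⟨hw0, hB⟩)] with q hq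
      rcases lt_or_ge ‖q.2‖ (a - 7 * d) with h7 | h7
      · rw [show q = (q.1, q.2) from rfl, Acore_core h7, G3_eq_inner hd hP0 h7.le]
      · rw [show q = (q.1, q.2) from rfl, Acore_shell3 h7 hq.2]
    refine ContMDiffAt.congr_of_eventuallyEq ?_ hev
    exact contMDiffAt_polar_of_periodic (F := fun θ r t ↦ G3 Ψ₀ P gφ a d θ r t) θ hw0
      (fun t ↦ (contMDiff_G3 hΨs hPs hPid hgs).contMDiffAt) (fun θ r t ↦ G3_add_one hgp θ r t)
  rcases lt_or_ge ‖w‖ a with hC | hC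
  · -- zone 2, in polar form
    have hev : Acore Ψ₀ Θ P gφ a d =ᶠ[𝓝 (θ, w)] fun q ↦ G2 Ψ₀ Θ a d q.1 ‖q.2‖ (angW q.2) := by
      have ho : IsOpen {q : Fb × 𝔼 2 | a - 4 * d < ‖q.2‖ ∧ ‖q.2‖ < a} :=
        (isOpen_lt continuous_const hnormc).inter (isOpen_lt hnormc continuous_const)
      filter_upwards [ho.mem_nhds (show (θ, w) ∈ {q : Fb × 𝔼 2 | a - 4 * d < ‖q.2‖ ∧ ‖q.2‖ < a}
        from ⟨by linarith, hC⟩)] with q hq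
      rcases lt_or_ge ‖q.2‖ (a - 7 * d / 2) with h3 | h3
      · rw [show q = (q.1, q.2) from rfl, Acore_shell3 (by linarith [hq.1]) h3,
          G2_eq_G3 hd hP1 hq.1.le (by linarith)]
      · rw [show q = (q.1, q.2) from rfl, Acore_shell2 hd h3 hq.2]
    refine ContMDiffAt.congr_of_eventuallyEq ?_ hev
    exact contMDiffAt_polar_of_periodic (F := fun θ r t ↦ G2 Ψ₀ Θ a d θ r t) θ hw0
      (fun t ↦ contMDiffAt_G2 hd (by linarith) hΨs hΘs θ (by linarith) t) (fun θ r t ↦ G2_add_one θ r t)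
  · -- the band
    have hev : Acore Ψ₀ Θ P gφ a d =ᶠ[𝓝 (θ, w)] fun q ↦ (Θ q.2 (Ψ₀ q.1)).1 := by
      have ho : IsOpen {q : Fb × 𝔼 2 | a - d < ‖q.2‖ ∧ ‖q.2‖ < a + 2 * d} :=
        (isOpen_lt continuous_const hnormc).inter (isOpen_lt hnormc continuous_const)
      filter_upwards [ho.mem_nhds (show (θ, w) ∈ {q : Fb × 𝔼 2 | a - d < ‖q.2‖ ∧ ‖q.2‖ < a + 2 * d}
        from ⟨by linarith, by linarith⟩)] with q hq
      have hq0 : q.2 ≠ 0 := by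
        rw [← norm_pos_iff]; linarith [hq.1]
      rcases lt_or_ge ‖q.2‖ a with h2 | h2
      · rw [show q = (q.1, q.2) from rfl, Acore_shell2 hd (by linarith [hq.1]) h2,
          G2_polar_eq_outer hd hq0 hq.1.le]
      · rw [show q = (q.1, q.2) from rfl, Acore_band hd h2]
    refine ContMDiffAt.congr_of_eventuallyEq ?_ hev
    have hin : ContMDiff ((𝓡 2).prod (𝓡 2)) (𝓘(ℝ, 𝔼 2).prod 𝓣) ∞
        fun q : Fb × 𝔼 2 ↦ ((q.2, Ψ₀ q.1) : 𝔼 2 × (Circle × Circle)) :=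
      contMDiff_snd.prodMk (hΨs.comp contMDiff_fst)
    have hopen : IsOpen ({w : 𝔼 2 | a - 3 * d < ‖w‖ ∧ ‖w‖ < a + 2 * d} ×ˢ (univ : Set (Circle × Circle))) :=
      ((isOpen_Ioo (a := a - 3 * d) (b := a + 2 * d)).preimage continuous_norm).prod isOpen_univ
    have hmem : ((w, Ψ₀ θ) : 𝔼 2 × (Circle × Circle)) ∈
        {w : 𝔼 2 | a - 3 * d < ‖w‖ ∧ ‖w‖ < a + 2 * d} ×ˢ (univ : Set (Circle × Circle)) :=
      ⟨⟨by linarith, by linarith⟩, mem_univ _⟩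
    have hΘat := hΘs.contMDiffAt (hopen.mem_nhds hmem)
    have hcomp := contMDiffAt_fst.comp (θ, w) (hΘat.comp (θ, w) hin.contMDiffAt)
    exact hcomp

/-! ### Fibrewise rank -/

/-- A slice `x ↦ Θ w x` is smooth for `w` in the annulus. [folklore] -/
theorem contMDiff_Θ_slice
    (hΘs : ContMDiffOn (𝓘(ℝ, 𝔼 2).prod 𝓣) 𝓣 ∞ (fun q : 𝔼 2 × (Circle × Circle) ↦ Θ q.1 q.2)
      ({w : 𝔼 2 | a - 3 * d < ‖w‖ ∧ ‖w‖ < a + 2 * d} ×ˢ univ))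
    {w : 𝔼 2} (h1 : a - 3 * d < ‖w‖) (h2 : ‖w‖ < a + 2 * d) : ContMDiff 𝓣 𝓣 ∞ (Θ w) :=
  hΘs.comp_contMDiff (f := fun x : Circle × Circle ↦ ((w, x) : 𝔼 2 × (Circle × Circle)))
    (contMDiff_const.prodMk contMDiff_id) fun _ ↦ ⟨⟨h1, h2⟩, mem_univ _⟩

/-- The first coordinate of `Θ w ∘ Ψ₀` has non-zero fibre differential. [folklore] -/
theorem mfderiv_fst_Θ_Ψ₀_ne_zero (hΨs : ContMDiff (𝓡 2) 𝓣 ∞ Ψ₀)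
    (hΨd : ∀ θ, Surjective (mfderiv (𝓡 2) 𝓣 Ψ₀ θ))
    (hΘs : ContMDiffOn (𝓘(ℝ, 𝔼 2).prod 𝓣) 𝓣 ∞ (fun q : 𝔼 2 × (Circle × Circle) ↦ Θ q.1 q.2)
      ({w : 𝔼 2 | a - 3 * d < ‖w‖ ∧ ‖w‖ < a + 2 * d} ×ˢ univ))
    (hΘd : ∀ w : 𝔼 2, a - 3 * d < ‖w‖ → ‖w‖ < a + 2 * d → ∀ x, Surjective (mfderiv 𝓣 𝓣 (Θ w) x))
    {w : 𝔼 2} (h1 : a - 3 * d < ‖w‖) (h2 : ‖w‖ < a + 2 * d) (θ : Fb) :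
    mfderiv (𝓡 2) (𝓡 1) (fun θ' ↦ (Θ w (Ψ₀ θ')).1) θ ≠ 0 := by
  have hΘw := contMDiff_Θ_slice hΘs h1 h2
  have h1' : Surjective (mfderiv (𝓡 2) 𝓣 (Θ w ∘ Ψ₀) θ) :=
    surjective_mfderiv_comp hΘw.contMDiffAt hΨs.contMDiffAt (hΘd w h1 h2 _) (hΨd θ)
  have h2' : Surjective (mfderiv (𝓡 2) (𝓡 1) (Prod.fst ∘ (Θ w ∘ Ψ₀)) θ) :=
    surjective_mfderiv_comp contMDiffAt_fst (hΘw.comp hΨs).contMDiffAt (surjective_mfderiv_fst_torus _) h1'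
  exact ne_zero_of_surjective_circle h2'

/-- **`Acore` is fibrewise submersive**: `θ ↦ Acore (θ, w)` has non-zero differential at every
point, for `‖w‖ < a + d`. [folklore] -/
theorem mfderiv_Acore_slice_ne_zero (hd : 0 < d) (ha : 0 < a - 7 * d) (hΨs : ContMDiff (𝓡 2) 𝓣 ∞ Ψ₀)
    (hΨd : ∀ θ, Surjective (mfderiv (𝓡 2) 𝓣 Ψ₀ θ))
    (hΘs : ContMDiffOn (𝓘(ℝ, 𝔼 2).prod 𝓣) 𝓣 ∞ (fun q : 𝔼 2 × (Circle × Circle) ↦ Θ q.1 q.2)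
      ({w : 𝔼 2 | a - 3 * d < ‖w‖ ∧ ‖w‖ < a + 2 * d} ×ˢ univ))
    (hΘd : ∀ w : 𝔼 2, a - 3 * d < ‖w‖ → ‖w‖ < a + 2 * d → ∀ x, Surjective (mfderiv 𝓣 𝓣 (Θ w) x))
    (hPs : ContMDiff (𝓘(ℝ, ℝ).prod (𝓘(ℝ, ℝ).prod 𝓣)) 𝓣 ∞
      fun p : ℝ × (ℝ × (Circle × Circle)) ↦ P p.1 p.2.1 p.2.2)
    (hPd : ∀ σ t x, Surjective (mfderiv 𝓣 𝓣 (P σ t) x))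
    {w : 𝔼 2} (hw : ‖w‖ < a + d) (θ : Fb) :
    mfderiv (𝓡 2) (𝓡 1) (fun θ' ↦ Acore Ψ₀ Θ P gφ a d (θ', w)) θ ≠ 0 := by
  rcases lt_or_ge ‖w‖ (a - 7 * d) with hA | hA
  · -- the core: `(Ψ₀ θ).1`
    rw [show (fun θ' ↦ Acore Ψ₀ Θ P gφ a d (θ', w)) = Prod.fst ∘ Ψ₀ from funext fun θ' ↦ Acore_core hA]
    exact ne_zero_of_surjective_circle
      (surjective_mfderiv_comp contMDiffAt_fst hΨs.contMDiffAt (surjective_mfderiv_fst_torus _) (hΨd θ))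
  rcases lt_or_ge ‖w‖ (a - 7 * d / 2) with hB | hB
  · -- zone 3/4: a rotation of `(P σ₀ τ₀ (Ψ₀ θ)).1`
    set c : Circle := Circle.exp (2 * π * ((κf a d ‖w‖ - 1) * gφ (angW w))) with hc
    set σ₀ : ℝ := lamf a d ‖w‖
    set τ₀ : ℝ := stepQ (Int.fract (angW w))
    have hPσ : ContMDiff 𝓣 𝓣 ∞ (P σ₀ τ₀) :=
      hPs.comp (contMDiff_const.prodMk (contMDiff_const.prodMk contMDiff_id))
    rw [show (fun θ' ↦ Acore Ψ₀ Θ P gφ a d (θ', w)) = (fun z : Circle ↦ c * z) ∘ (Prod.fst ∘ (P σ₀ τ₀ ∘ Ψ₀))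
      from funext fun θ' ↦ Acore_shell3 hA hB]
    refine ne_zero_of_surjective_circle (surjective_mfderiv_comp (contMDiff_mul_left (a := c)).contMDiffAt
      (contMDiff_fst.comp (hPσ.comp hΨs)).contMDiffAt (surjective_mfderiv_mul_left c _) ?_)
    refine surjective_mfderiv_comp contMDiffAt_fst (hPσ.comp hΨs).contMDiffAt (surjective_mfderiv_fst_torus _) ?_
    exact surjective_mfderiv_comp hPσ.contMDiffAt hΨs.contMDiffAt (hPd σ₀ τ₀ _) (hΨd θ)
  have hw0 : 0 < ‖w‖ := by linarith
  rcases lt_or_ge ‖w‖ a with hC | hC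
  · -- zone 2: `(Θ w' (Ψ₀ θ)).1` with `w' = Rf r • circlePt (Tf r t₀)`
    set w' : 𝔼 2 := Rf a d ‖w‖ • ((circlePt (Tf a d ‖w‖ (angW w)) : 𝕊¹) : 𝔼 2) with hw'
    have hn : ‖w'‖ = Rf a d ‖w‖ := norm_smul_circlePt (Rf_pos hd (by linarith) (by linarith)).le _
    obtain ⟨hR1, hR2⟩ := Rf_mem hd (show ‖w‖ < a + 2 * d by linarith)
    rw [show (fun θ' ↦ Acore Ψ₀ Θ P gφ a d (θ', w)) = fun θ' ↦ (Θ w' (Ψ₀ θ')).1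
      from funext fun θ' ↦ Acore_shell2 hd hB hC]
    exact mfderiv_fst_Θ_Ψ₀_ne_zero hΨs hΨd hΘs hΘd (by rw [hn]; linarith) (by rw [hn]; exact hR2) θ
  · -- the band
    rw [show (fun θ' ↦ Acore Ψ₀ Θ P gφ a d (θ', w)) = fun θ' ↦ (Θ w (Ψ₀ θ')).1
      from funext fun θ' ↦ Acore_band hd hC]
    exact mfderiv_fst_Θ_Ψ₀_ne_zero hΨs hΨd hΘs hΘd (by linarith) (by linarith) θ

end Core

end DiscExt

end Summit.SmoothPoincare4.SmoothPoincare4.Cruxes.RungOne.Sketch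

end
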